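import Literature.NumberTheory.Transcendental.MahlerManin
import Literature.NumberTheory.Transcendental.MahlerManinSiegelStep
import Literature.NumberTheory.Transcendental.MahlerManinPadicStep
import Literature.NumberTheory.Transcendental.MahlerManinLiouvilleStep
import Literature.NumberTheory.Transcendental.MahlerManinEndgame
import HarnessLib

/-!
# The Mahler–Manin theorem from prime-level modular relations (conclusion of the proof)

Everything in this file is **proved**; there are no new definitions.  We assemble the five steps
(`MahlerManinSiegelStep`, `MahlerManinPadicStep`, `MahlerManinLiouvilleStep`,
`MahlerManinEndgame`) of the `p`-adic proof of the Mahler–Manin conjecture after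
Barré-Sirieix–Diaz–Gramain–Philibert (1996) and Nesterenko–Philippon (LNM 1752, Ch. 2, Thm. 2.11),
in a form whose ONLY remaining input is the family of modular equations of PRIME level:

* `tateJ_transcendental_of_relations` — let `q ∈ ℚ_p`, `0 < ‖q‖ < 1`, be algebraic over `ℚ`, and
  suppose that for every prime `ℓ` we are given `Φ_ℓ ∈ ℤ[X][Y]`, monic of degree `ℓ + 1` in `X`,
  with coefficients of degree `≤ ℓ + 1` in `Y` and of absolute value `≤ exp(c ℓ √ℓ)`, such that
  `Φ_ℓ(J(q^ℓ), J(q)) = 0` in `ℚ_p` (`J = tateJ = E₄³/Δ`).  Then `J(q)` is transcendental.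
* `mahlerManinPadic_of_relations` — hence the named fact
  `Literature.NumberTheory.Transcendental.MahlerManinPadic` (BDGP 1996, Théorème 1, `p`-adic case)
  follows from the existence of such relations at every `q`.

The classical modular polynomials `Φ_ℓ` (Lang, *Elliptic Functions*, Ch. 5 §2; in the tree
`Literature.NumberTheory.EllipticCurves.modularPolynomial`, with `Φ_ℓ(j(ℓτ), j(τ)) = 0`,
`ModularPolynomial.lean`) have these properties: integrality and `deg_Y = ℓ + 1` by Cox, Thm. 11.18,
and `log |coeff| ≤ 6(ℓ+1)(log ℓ + O(1))` by P. Cohen (1984); the passage from the identity on `ℍ`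
to the `p`-adic identity is the `q`-expansion principle.  That bridge is the business of a sibling
file; here the relations are hypotheses.

## The argument (Nesterenko–Philippon Ch. 2 §2.5, `p`-adic version)

Suppose `J(q)` algebraic.  Fix the constants `d₀, c_q, c_J` of the Liouville step and `T₀` of the
endgame, and take an integer `T > T₀`.  Siegel's lemma gives `F = Σ a_λ X^{λ₁}(XJ)^{λ₂} ≠ 0`
(`λ₁ < 2T⁶`, `λ₂ < T⁴`) vanishing to order `M ≥ T¹⁰`; let `S` be the least prime with
`F(q^S) ≠ 0` (third step).  Then `S M λ ≤ -log ‖F(q^S)‖_p` (second step) is bounded above by the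
Liouville estimate (fourth step), while the zero estimate and Chebyshev bound `S`; the endgame
turns these into `T ≤ T₀`, a contradiction.

## References

* [BarreSirieixDiazGramainPhilibert1996Manin] K. Barré-Sirieix, G. Diaz, F. Gramain,
  G. Philibert, *Une preuve de la conjecture de Mahler–Manin*, Invent. Math. 124 (1996) 1–9,
  Théorème 1.
* [NesterenkoPhilippon2001] Yu. V. Nesterenko, P. Philippon (eds.), LNM 1752, Ch. 2 (G. Diaz),
  Thm. 2.11 and §2.5.
-/

noncomputable section

open Finset PowerSeries Real Literature.NumberTheory.EllipticCurves

namespace Literature.NumberTheory.Transcendental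

/-- **The Mahler–Manin theorem, `p`-adic case, from prime-level modular relations**
(Barré-Sirieix–Diaz–Gramain–Philibert 1996, Théorème 1; Nesterenko–Philippon Ch. 2, Thm. 2.11):
if `q ∈ ℚ_p` with `0 < ‖q‖ < 1` is algebraic and for every prime `ℓ` there is an integer
polynomial `Φ_ℓ ∈ ℤ[X][Y]`, monic of degree `ℓ + 1` in `X`, with `Y`-degrees `≤ ℓ + 1`,
coefficients `≤ exp(c ℓ √ℓ)` in absolute value and `Φ_ℓ(J(q^ℓ), J(q)) = 0`, then `J(q) = tateJ q`
is transcendental over `ℚ`. [cite: NesterenkoPhilippon2001, Ch. 2, Thm. 2.11] -/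
theorem tateJ_transcendental_of_relations (p : ℕ) [Fact p.Prime] {q : ℚ_[p]} (hq0 : q ≠ 0)
    (hq1 : ‖q‖ < 1) (hq : IsAlgebraic ℚ q) (Φ : ℕ → Polynomial (Polynomial ℤ)) (cΦ : ℝ)
    (hmonic : ∀ ℓ, ℓ.Prime → (Φ ℓ).Monic)
    (hdeg : ∀ ℓ, ℓ.Prime → (Φ ℓ).natDegree = ℓ + 1)
    (hdegY : ∀ ℓ, ℓ.Prime → ∀ m, ((Φ ℓ).coeff m).natDegree ≤ ℓ + 1)
    (hsize : ∀ ℓ, ℓ.Prime → ∀ m i,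
      |((((Φ ℓ).coeff m).coeff i : ℤ) : ℝ)| ≤ Real.exp (cΦ * ℓ * Real.sqrt ℓ))
    (hrel : ∀ ℓ, ℓ.Prime →
      ((Φ ℓ).map (Polynomial.eval₂RingHom (Int.castRingHom ℚ_[p]) (tateJ q))).eval
        (tateJ (q ^ ℓ)) = 0) :
    Transcendental ℚ (tateJ q) := by
  classical
  intro hJ
  -- the constants
  obtain ⟨d₀, cq, cJ, hd₀, hcq, hcJ, hLiou⟩ := neg_log_norm_auxValue_le hq hJ
  obtain ⟨cΦ', hcΦ'⟩ : ∃ c : ℝ, c = max cΦ 0 := ⟨_, rfl⟩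
  have hcΦ'0 : 0 ≤ cΦ' := by rw [hcΦ']; exact le_max_right _ _
  have hsize' : ∀ ℓ, ℓ.Prime → ∀ m i,
      |((((Φ ℓ).coeff m).coeff i : ℤ) : ℝ)| ≤ Real.exp (cΦ' * ℓ * Real.sqrt ℓ) := by
    intro ℓ hℓ m i
    refine (hsize ℓ hℓ m i).trans (Real.exp_le_exp.mpr ?_)
    have : cΦ ≤ cΦ' := by rw [hcΦ']; exact le_max_left _ _
    have : 0 ≤ (ℓ : ℝ) * Real.sqrt ℓ := by positivity
    nlinarith
  obtain ⟨lam, hlamdef⟩ : ∃ lam : ℝ, lam = -Real.log ‖q‖ := ⟨_, rfl⟩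
  have hlam : 0 < lam := by
    rw [hlamdef, neg_pos]
    exact Real.log_neg (norm_pos_iff.mpr hq0) hq1
  have hd₀' : (0 : ℝ) ≤ d₀ := by positivity
  obtain ⟨T₀, hT₀⟩ := mahlerManin_parameter_bound hlam hd₀' hcq hcJ hcΦ'0
  -- the parameter `T > T₀`
  obtain ⟨T, hTdef⟩ : ∃ T : ℕ, T = ⌈T₀⌉₊ + 1 := ⟨_, rfl⟩
  have hT1 : 1 ≤ T := by omega
  have hTT₀ : T₀ < T := by
    have := Nat.le_ceil T₀
    rw [hTdef]; push_cast; linarith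
  -- first step: the auxiliary function
  obtain ⟨a, M, hsupp, ha, hLa, hNM, hbM, hlt, hbn⟩ := exists_auxiliary T hT1
  -- third step: the least non-vanishing prime
  obtain ⟨S, hSprime, hFS, -, hZE⟩ := exists_least_prime hq0 hq1 hlt hbM
  have hS1 : 1 ≤ S := hSprime.one_lt.le
  have hqS0 : q ^ S ≠ 0 := pow_ne_zero S hq0
  have hqS1 : ‖q ^ S‖ < 1 := by rw [norm_pow]; exact pow_lt_one₀ (norm_nonneg _) hq1 hSprime.ne_zero
  -- the value `v = F(q^S) ≠ 0`
  have hv := evalSeries_sum_C_mul_X_pow_mul (range (2 * T ^ 6) ×ˢ range (T ^ 4)) a hqS0 hqS1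
  rw [hv] at hFS
  -- second step: `S M λ ≤ -log ‖v‖`
  have hup := norm_evalSeries_le_pow _ hlt hqS1
  rw [hv, norm_pow, ← pow_mul] at hup
  have hvpos : 0 < ‖∑ l ∈ range (2 * T ^ 6) ×ˢ range (T ^ 4),
      (a l : ℚ_[p]) * (q ^ S) ^ l.1 * (q ^ S * tateJ (q ^ S)) ^ l.2‖ := norm_pos_iff.mpr hFS
  have hlow1 : (S : ℝ) * M * lam ≤ -Real.log ‖∑ l ∈ range (2 * T ^ 6) ×ˢ range (T ^ 4),
      (a l : ℚ_[p]) * (q ^ S) ^ l.1 * (q ^ S * tateJ (q ^ S)) ^ l.2‖ := by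
    have h := Real.log_le_log hvpos hup
    rw [Real.log_pow] at h
    push_cast at h
    rw [hlamdef]
    nlinarith
  -- fourth step: the Liouville estimate
  have hB : ∀ l ∈ range (2 * T ^ 6) ×ˢ range (T ^ 4), l.1 ≤ 2 * T ^ 6 ∧ l.2 ≤ T ^ 4 := by
    intro l hl
    obtain ⟨h1, h2⟩ := mem_product.mp hl
    exact ⟨(mem_range.mp h1).le, (mem_range.mp h2).le⟩
  have hlow2 := hLiou S hS1 (Φ S) (S + 1) (hmonic S hSprime) (hdegY S hSprime) (hrel S hSprime)
    (range (2 * T ^ 6) ×ˢ range (T ^ 4)) a (2 * T ^ 6) (T ^ 4) hB hFS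
  -- the quantities fed to the endgame
  obtain ⟨La, hLadef⟩ : ∃ La : ℝ, La = ∑ l ∈ range (2 * T ^ 6) ×ˢ range (T ^ 4), |(a l : ℝ)| :=
    ⟨_, rfl⟩
  obtain ⟨LΦ, hLΦdef⟩ : ∃ LΦ : ℝ, LΦ = ∑ m ∈ range ((Φ S).natDegree + 1),
      ∑ i ∈ range (S + 1 + 1), |((((Φ S).coeff m).coeff i : ℤ) : ℝ)| := ⟨_, rfl⟩
  rw [← hLadef, ← hLΦdef] at hlow2
  rw [← hLadef] at hLa hbn
  -- `La ≥ 1`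
  have hLa1 : 1 ≤ La := by
    obtain ⟨l₀, hl₀⟩ := Function.ne_iff.mp ha
    have hmem : l₀ ∈ range (2 * T ^ 6) ×ˢ range (T ^ 4) := by
      by_contra h; exact hl₀ (hsupp l₀ h)
    have h1 : (1 : ℝ) ≤ |(a l₀ : ℝ)| := by
      rw [← Int.cast_abs]; exact_mod_cast Int.one_le_abs hl₀
    rw [hLadef]
    exact h1.trans (single_le_sum (f := fun l ↦ |(a l : ℝ)|) (fun l _ ↦ abs_nonneg _) hmem)
  -- `|b_M| ≥ 1`
  have hbM1 : (1 : ℝ) ≤ |((coeff M (∑ l ∈ range (2 * T ^ 6) ×ˢ range (T ^ 4),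
      PowerSeries.C (a l) * X ^ l.1 * formalXJ ^ l.2) : ℤ) : ℝ)| := by
    rw [← Int.cast_abs]; exact_mod_cast Int.one_le_abs hbM
  -- `LΦ ≤ (S+2)² exp(c S √S)`
  have hLΦ0 : 0 ≤ LΦ := by
    rw [hLΦdef]; exact sum_nonneg fun m _ ↦ sum_nonneg fun i _ ↦ abs_nonneg _
  have hLΦle : LΦ ≤ ((S : ℝ) + 2) ^ 2 * Real.exp (cΦ' * S * Real.sqrt S) := by
    rw [hLΦdef]
    calc ∑ m ∈ range ((Φ S).natDegree + 1), ∑ i ∈ range (S + 1 + 1),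
          |((((Φ S).coeff m).coeff i : ℤ) : ℝ)|
        ≤ ∑ m ∈ range ((Φ S).natDegree + 1), ∑ i ∈ range (S + 1 + 1),
            Real.exp (cΦ' * S * Real.sqrt S) :=
          sum_le_sum fun m _ ↦ sum_le_sum fun i _ ↦ hsize' S hSprime m i
      _ = ((S : ℝ) + 2) ^ 2 * Real.exp (cΦ' * S * Real.sqrt S) := by
          rw [sum_const, sum_const, card_range, card_range, hdeg S hSprime, nsmul_eq_mul,
            nsmul_eq_mul]
          push_cast
          ring
  -- the main inequality
  have hmain : (S : ℝ) * M * lam ≤ d₀ * ((S : ℝ) + 1) * (Real.log La +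
      S * (2 * (T : ℝ) ^ 6 + (T : ℝ) ^ 4) * cq +
        (T : ℝ) ^ 4 * (Real.log (max 1 LΦ) + ((S : ℝ) + 1) * cJ)) := by
    refine hlow1.trans (hlow2.trans (le_of_eq ?_))
    rw [hdeg S hSprime, max_eq_right hLa1]
    push_cast
    ring
  -- Chebyshev
  have hCheb : (16 : ℝ) ≤ S → (S : ℝ) ^ 2 / (32 * Real.log S ^ 2) ≤
      ∑ ℓ ∈ S.primesBelow, (ℓ : ℝ) := by
    intro h
    exact sq_div_log_sq_le_sum_primesBelow (by exact_mod_cast h)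
  -- the endgame
  have hS2 : (2 : ℝ) ≤ S := by exact_mod_cast hSprime.two_le
  have hT1' : (1 : ℝ) ≤ T := by exact_mod_cast hT1
  have hNM' : (T : ℝ) ^ 10 ≤ M := by exact_mod_cast hNM
  have hZE' : (∑ ℓ ∈ S.primesBelow, (ℓ : ℝ)) * lam ≤ Real.log |((coeff M
      (∑ l ∈ range (2 * T ^ 6) ×ˢ range (T ^ 4), PowerSeries.C (a l) * X ^ l.1 * formalXJ ^ l.2) :
        ℤ) : ℝ)| := by rw [hlamdef]; exact hZE
  have key := hT₀ T M S La _ _ LΦ hT1' hNM' hS2 hLa1 hLa hbM1 (hbn M) hZE' hCheb hLΦ0 hLΦle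
    hmain
  linarith

/-- **`MahlerManinPadic` from prime-level modular relations.**  If for every prime `p` and every
`q ∈ ℚ_p` with `0 < ‖q‖ < 1` there is a family `(Φ_ℓ)_{ℓ prime}` of integer modular relations as
in `tateJ_transcendental_of_relations` (monic of degree `ℓ+1` in `X`, `Y`-degrees `≤ ℓ+1`,
coefficients `≤ exp(c ℓ √ℓ)`, `Φ_ℓ(J(q^ℓ), J(q)) = 0`), then the Mahler–Manin theorem
`MahlerManinPadic` (Barré-Sirieix–Diaz–Gramain–Philibert 1996, Théorème 1) holds.
[cite: BarreSirieixDiazGramainPhilibert1996Manin, Théorème 1] -/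
theorem mahlerManinPadic_of_relations
    (h : ∀ (p : ℕ) [Fact p.Prime] (q : ℚ_[p]), q ≠ 0 → ‖q‖ < 1 →
      ∃ (Φ : ℕ → Polynomial (Polynomial ℤ)) (cΦ : ℝ),
        (∀ ℓ, ℓ.Prime → (Φ ℓ).Monic) ∧ (∀ ℓ, ℓ.Prime → (Φ ℓ).natDegree = ℓ + 1) ∧
        (∀ ℓ, ℓ.Prime → ∀ m, ((Φ ℓ).coeff m).natDegree ≤ ℓ + 1) ∧
        (∀ ℓ, ℓ.Prime → ∀ m i,
          |((((Φ ℓ).coeff m).coeff i : ℤ) : ℝ)| ≤ Real.exp (cΦ * ℓ * Real.sqrt ℓ)) ∧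
        (∀ ℓ, ℓ.Prime →
          ((Φ ℓ).map (Polynomial.eval₂RingHom (Int.castRingHom ℚ_[p]) (tateJ q))).eval
            (tateJ (q ^ ℓ)) = 0)) :
    MahlerManinPadic := by
  intro p _ q hq0 hq1 hq
  obtain ⟨Φ, cΦ, h1, h2, h3, h4, h5⟩ := h p q hq0 hq1
  exact tateJ_transcendental_of_relations p hq0 hq1 hq Φ cΦ h1 h2 h3 h4 h5

end Literature.NumberTheory.Transcendental

end
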